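import Summits.Ventures.HSemireg.WedgeHankelRecurrenceGaussJacobiSumRules
import Literature.Analysis.FunctionSpaces.SquaredBessel

/-!
# Venture HSemireg — **HOFFMAN–WIELANDT FOR THE CLASSICAL FAMILIES: the Laguerre zeros are `ℓ²`-HÖLDER in `α`** — for `α, α' > −1` and the increasing zeros `x(α)`, `x(α')` of
# `L_{t+1}^{(α)}`, `L_{t+1}^{(α')}`: **`Σ_k (x_k(α') − x_k(α))² ≤ (t+1)(α'−α)² + t(t+1)|α'−α|`** (N417 with `a_i = 2i+1+α`, `b_i = i(i+α)` and `(√u − √v)² ≤ |u − v|`); similarly the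
# Gegenbauer zeros in `λ` with equal (zero) diagonals: `Σ (y_k − x_k)² ≤ 2 Σ_{i<t} |b'_{i+1} − b_{i+1}|`

HONEST FRAMING. Part of the Lean index of the computation cell `pub-hsemireg` (seat p10 gen 47, Sunday typer «UNIFORM-IN-n»).  `Real.sqrt`, absolute values and finite sums only; no variety, no
cohomology theory, no sheaf, no Ext group and no semiregularity map is constructed here; nothing here says that HC / HC_CM / HC_AV holds; no Literature fact (unproved `Prop`) is declared or used.
Custodian versions as in `WedgeHankelSiegelIdeal` (1/3).
SOURCES (cited).  A. J. Hoffman, H. W. Wielandt, Duke Math. J. 20 (1953) 37–39; W. Gautschi, *Orthogonal Polynomials* (2004), §3.1 (conditioning of the map from recurrence coefficients to Gauss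
nodes); G. Szegő, *Orthogonal Polynomials*, §6.21 (dependence of the classical zeros on the parameter).  The explicit Laguerre ∕ Gegenbauer bounds are COROLLARIES typed here of N417; no separate
printed locator is claimed.
PROOF TYPED HERE.  `(√u − √v)² ≤ |u − v|` (`Literature…sq_sqrt_sub_sqrt_le`); N417 `hoffman_wielandt_recurrence` ∕ N418 `hoffman_wielandt_couplings`; `Σ_{i<t} (i+1) = t(t+1)∕2`.
DEDUP DISCLOSURE (`rg -n -i 'lipschitz|holder|sqrt_sub_sqrt_sq' Summits/Ventures/HSemireg/WedgeHankelRecurrenceGauss*`, 2026-09-04): nothing; the Hölder step `(√a − √b)² ≤ |a − b|` is the LANDED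
`Literature.Analysis.FunctionSpaces.sq_sqrt_sub_sqrt_le` (imported and used, not restated); 0 hits for the 2 names below.

WHAT IS IN THE TREE.  N417 `hoffman_wielandt_recurrence`; N418 `hoffman_wielandt_couplings`; `Literature.Analysis.FunctionSpaces.sq_sqrt_sub_sqrt_le`.
THIS FILE (namespace `Summit.Ventures.HSemireg.Wedge.HankelOuter` continued; CHAINED on N423 (import only); 0 definitions):
* §1189 **`laguerre_zeros_sq_dist_le`** (`Σ (x_k(α') − x_k(α))² ≤ (t+1)(α'−α)² + t(t+1)|α'−α|`), **`zeros_sq_dist_le_couplings_abs`**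
  (equal diagonals: `Σ (y_k − x_k)² ≤ 2 Σ_{i<t} |b'_{i+1} − b_{i+1}|`).
CAVEATS.  `α, α' > −1` (positivity of the Laguerre couplings `b_i = i(i+α)`).  Nothing Ext-side.  New names only.
-/

open Module Polynomial
open scoped Matrix Polynomial

namespace Summit.Ventures.HSemireg.Wedge.HankelOuter

/-! ## §1189. `ℓ²`-continuity of the classical zeros in the parameter -/

/-- **Equal diagonals: `Σ_k (y_k − x_k)² ≤ 2 Σ_{i<t} |b'_{i+1} − b_{i+1}|`.** [corollary of Hoffman–Wielandt 1953; this file, §1189] -/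
theorem zeros_sq_dist_le_couplings_abs {q q' : ℕ → ℝ[X]} {a b b' : ℕ → ℝ} (hq0 : q 0 = 1) (hq1 : q 1 = Polynomial.X - C (a 0))
    (hrec : ∀ n, q (n + 2) = (Polynomial.X - C (a (n + 1))) * q (n + 1) - C (b (n + 1)) * q n) (hq0' : q' 0 = 1) (hq1' : q' 1 = Polynomial.X - C (a 0))
    (hrec' : ∀ n, q' (n + 2) = (Polynomial.X - C (a (n + 1))) * q' (n + 1) - C (b' (n + 1)) * q' n) (hb : ∀ j, 0 < b j) (hb' : ∀ j, 0 < b' j) {t : ℕ}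
    {x y : Fin (t + 1) → ℝ} (hx : StrictMono x) (hxq : q (t + 1) = ∏ k, (Polynomial.X - C (x k))) (hy : StrictMono y) (hyq : q' (t + 1) = ∏ k, (Polynomial.X - C (y k))) :
    ∑ k, (y k - x k) ^ 2 ≤ 2 * ∑ i ∈ Finset.range t, |b' (i + 1) - b (i + 1)| :=
  (hoffman_wielandt_couplings hq0 hq1 hrec hq0' hq1' hrec' hb hb' hx hxq hy hyq).trans
    (mul_le_mul_of_nonneg_left (Finset.sum_le_sum fun i _ => Literature.Analysis.FunctionSpaces.sq_sqrt_sub_sqrt_le (hb' (i + 1)).le (hb (i + 1)).le) (by norm_num))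

/-- **LAGUERRE ZEROS ARE `ℓ²`-HÖLDER IN `α`: `Σ_k (x_k(α') − x_k(α))² ≤ (t+1)(α'−α)² + t(t+1)|α'−α|`** (`α, α' > −1`). [corollary of Hoffman–Wielandt 1953; Gautschi §3.1; this file, §1189] -/
theorem laguerre_zeros_sq_dist_le {L L' : ℕ → ℝ[X]} {a a' b b' : ℕ → ℝ} {α α' : ℝ} (hL0 : L 0 = 1) (hL1 : L 1 = Polynomial.X - C (a 0))
    (hLrec : ∀ n, L (n + 2) = (Polynomial.X - C (a (n + 1))) * L (n + 1) - C (b (n + 1)) * L n) (ha : ∀ n, a n = 2 * n + 1 + α)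
    (hb : ∀ n, b (n + 1) = ((n : ℝ) + 1) * ((n : ℝ) + 1 + α)) (hb0 : 0 < b 0) (hα : -1 < α) (hL0' : L' 0 = 1) (hL1' : L' 1 = Polynomial.X - C (a' 0))
    (hLrec' : ∀ n, L' (n + 2) = (Polynomial.X - C (a' (n + 1))) * L' (n + 1) - C (b' (n + 1)) * L' n) (ha' : ∀ n, a' n = 2 * n + 1 + α')
    (hb' : ∀ n, b' (n + 1) = ((n : ℝ) + 1) * ((n : ℝ) + 1 + α')) (hb0' : 0 < b' 0) (hα' : -1 < α') {t : ℕ}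
    {x y : Fin (t + 1) → ℝ} (hx : StrictMono x) (hxq : L (t + 1) = ∏ k, (Polynomial.X - C (x k))) (hy : StrictMono y) (hyq : L' (t + 1) = ∏ k, (Polynomial.X - C (y k))) :
    ∑ k, (y k - x k) ^ 2 ≤ ((t : ℝ) + 1) * (α' - α) ^ 2 + (t : ℝ) * ((t : ℝ) + 1) * |α' - α| := by
  have hbp : ∀ j, 0 < b j := fun j => by
    rcases j with _ | k
    · exact hb0
    · rw [hb]; have h0 : (0 : ℝ) ≤ k := Nat.cast_nonneg k; exact mul_pos (by linarith) (by linarith)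
  have hbp' : ∀ j, 0 < b' j := fun j => by
    rcases j with _ | k
    · exact hb0'
    · rw [hb']; have h0 : (0 : ℝ) ≤ k := Nat.cast_nonneg k; exact mul_pos (by linarith) (by linarith)
  have h := hoffman_wielandt_recurrence hL0 hL1 hLrec hL0' hL1' hLrec' hbp hbp' hx hxq hy hyq
  have hdiag : ∑ i ∈ Finset.range (t + 1), (a' i - a i) ^ 2 = ((t : ℝ) + 1) * (α' - α) ^ 2 := by
    rw [Finset.sum_congr rfl fun i _ => by rw [ha', ha, show (2 * (i : ℝ) + 1 + α' - (2 * (i : ℝ) + 1 + α)) = α' - α by ring], Finset.sum_const, Finset.card_range, nsmul_eq_mul]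
    push_cast; ring
  have hoff : ∑ i ∈ Finset.range t, (Real.sqrt (b' (i + 1)) - Real.sqrt (b (i + 1))) ^ 2 ≤ ∑ i ∈ Finset.range t, ((i : ℝ) + 1) * |α' - α| := by
    refine Finset.sum_le_sum fun i _ => (Literature.Analysis.FunctionSpaces.sq_sqrt_sub_sqrt_le (hbp' (i + 1)).le (hbp (i + 1)).le).trans (le_of_eq ?_)
    rw [hb', hb, show ((i : ℝ) + 1) * ((i : ℝ) + 1 + α') - ((i : ℝ) + 1) * ((i : ℝ) + 1 + α) = ((i : ℝ) + 1) * (α' - α) by ring, abs_mul,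
      abs_of_nonneg (by positivity : (0 : ℝ) ≤ (i : ℝ) + 1)]
  have hsum : ∑ i ∈ Finset.range t, ((i : ℝ) + 1) * |α' - α| = (t : ℝ) * ((t : ℝ) + 1) / 2 * |α' - α| := by
    rw [← Finset.sum_mul]
    congr 1
    have h2 := Finset.sum_range_id_mul_two (t + 1)
    rw [Finset.sum_range_succ', Nat.add_sub_cancel] at h2
    have h3 : (∑ i ∈ Finset.range t, ((i : ℝ) + 1)) * 2 = ((t : ℝ) + 1) * t := by
      have := congrArg (fun n : ℕ => (n : ℝ)) h2
      push_cast at this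
      linarith
    linarith
  rw [hdiag] at h
  rw [hsum] at hoff
  linarith

end Summit.Ventures.HSemireg.Wedge.HankelOuter
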